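import Literature.AlgebraicGeometry.Motives.AbelianVarietyGoodReductionConjugate
import Literature.NumberTheory.EllipticCurves.NeronModel
import Mathlib.CategoryTheory.HomCongr
import HarnessLib

/-!
# The Néron mapping property is stable under base change along an automorphism of the base
# (transport of structure; [BLR 1990, 1.2 Prop. 2 (c) / §7.2], [Shimura 1998, §18.6 p. 129 «(Y^σ)~ = Ỹ^f»])

Layer `Literature/AlgebraicGeometry/Motives`, namespace `Literature.AlgebraicGeometry.Motives`.  THEOREMS ONLY (no definition, no
named fact, no instance; net Literature debt **0**).  Written for the cell `hodgecm-mathlib` (D-0151), fan B-II, line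
`b2_main_theorem_cm` (crux item stmt-HodgeConjecture-24834, row II-1), the FactRH′ COMPANIONS edition (lead B-p19,
`AbelianVarietyGoodReductionHomConjFrob.lean` §3): its datum-intrinsic Néron-lift constructor
`HomReduction.nonempty_of_mappingProperty` needs, for the conjugate model `𝒳 ⊗_{𝓞_v, γᵥ} 𝓞_v` of B-p12's `conjOfSquares`/`conjFrob`
(`AbelianVarietyGoodReductionConjugate.lean` §4), the NÉRON MAPPING PROPERTY at smooth sources — which the abelian-scheme model `𝒜`
has (`isNeronModel_of_isAbelianSchemeModel`, B-p07 p608513) and which this file TRANSPORTS along the base automorphism `γᵥ`: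

* `baseChangeHom_ringEquiv_map_bijective` — base change of `R₁`-schemes along a ring ISOMORPHISM `σ : R₁ ≃+* R₂` is fully faithful
  (it is an equivalence `SchemeOver R₁ ≌ SchemeOver R₂` with inverse base change along `σ⁻¹`; Mathlib `Over.pullbackComp`,
  `Over.pullbackId`, the cell's `baseChangeHomCompIso`);
* `mappingProperty_baseChangeHom_ringEquiv` — MAIN: if `𝒩 → Spec R₀` has the Néron mapping property with respect to the generic
  fibre functor `genericFibre R₀ K` («for every smooth `𝒳`, `Hom_{R₀}(𝒳, 𝒩) → Hom_K(𝒳_K, 𝒩_K)` is bijective», the field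
  `IsNeronModel.mappingProperty`), then so has `𝒩 ⊗_{R₀, φ} R₀` for every ring automorphism `φ` of `R₀` lying under an automorphism
  `γ` of `K` (`algebraMap ∘ φ = γ ∘ algebraMap`).  Proof: `Hom(𝒳, φ^*𝒩) ≃ Hom(φ⁻¹^*𝒳, 𝒩)` (equivalence + counit), the generic fibre of
  `φ⁻¹^*𝒳` is the `γ⁻¹`-conjugate of that of `𝒳` (`baseChangeHomCommIso`), `γ⁻¹`-conjugation is fully faithful on `K`-schemes, and
  `φ⁻¹^*𝒳` is smooth (base change); the two bijections intertwine the generic-fibre maps by naturality.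

Pure transport of structure — no group objects, no properness, no number fields.  HC_CM is proved only modulo the 7 printed
citations until rung 0 closes; this file adds no hypothesis to anything.

## References
* [BLRNeronModels1990] S. Bosch, W. Lütkebohmert, M. Raynaud, *Néron Models*, Springer (1990), §1.2 Def. 1 and Prop. 2
  (compatibility of the Néron property with base change), §7.2.
* [Shimura1998] G. Shimura, *Abelian Varieties with Complex Multiplication and Modular Functions* (1998), §18.6 proof of Thm. 18.6,
  p. 129 («`(Y^σ)~ = Ỹ^f` for every object `Y` rational over `L`»).
* [GortzWedhorn2020] U. Görtz, T. Wedhorn, *Algebraic Geometry I*, 2nd ed., Prop. 4.16 and §(4.7) (transitivity of base change).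
-/

set_option autoImplicit false

open CategoryTheory AlgebraicGeometry
open Literature.NumberTheory.EllipticCurves (genericFibre specGenericPoint)

namespace Literature.AlgebraicGeometry.Motives

universe u

/-! ## Base change along a ring isomorphism is fully faithful -/

section RingEquiv

variable {R₁ R₂ : Type u} [CommRing R₁] [CommRing R₂]

/-- `Spec (id) = 𝟙`, hence base change along `RingHom.id` is (isomorphic to) the identity functor: the pullback functors
agree on the nose. [cite: GortzWedhorn2020, Section (4.7)] -/
theorem baseChangeHom_id_eq_pullback_id :
    (baseChangeHom (RingHom.id R₁) : SchemeOver R₁ ⥤ SchemeOver R₁) = Over.pullback (𝟙 (Spec (.of R₁))) := by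
  change Over.pullback (Spec.map (CommRingCat.ofHom (RingHom.id R₁))) = _
  exact AbelianVariety.overPullback_congr (by rw [CommRingCat.ofHom_id, Spec.map_id])

/-- **Base change along a ring isomorphism `σ : R₁ ≃+* R₂` is an equivalence of categories `SchemeOver R₁ ≌ SchemeOver R₂`**
(inverse: base change along `σ⁻¹`; unit and counit from transitivity `baseChangeHomCompIso` and `Over.pullbackId`), recorded as
the existence of an equivalence whose functor IS `baseChangeHom σ`. [cite: GortzWedhorn2020, Prop. 4.16 and §(4.7)] -/
theorem exists_equivalence_baseChangeHom_ringEquiv (σ : R₁ ≃+* R₂) :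
    ∃ e : SchemeOver R₁ ≌ SchemeOver R₂, e.functor = baseChangeHom σ.toRingHom := by
  have h₁ : σ.toRingHom.comp σ.symm.toRingHom = RingHom.id R₂ := by
    ext x; simp
  have h₂ : σ.symm.toRingHom.comp σ.toRingHom = RingHom.id R₁ := by
    ext x; simp
  let idIso₁ : (baseChangeHom (RingHom.id R₁) : SchemeOver R₁ ⥤ SchemeOver R₁) ≅ 𝟭 _ :=
    eqToIso baseChangeHom_id_eq_pullback_id ≪≫ Over.pullbackId
  let idIso₂ : (baseChangeHom (RingHom.id R₂) : SchemeOver R₂ ⥤ SchemeOver R₂) ≅ 𝟭 _ :=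
    eqToIso baseChangeHom_id_eq_pullback_id ≪≫ Over.pullbackId
  refine ⟨CategoryTheory.Equivalence.mk (baseChangeHom σ.toRingHom) (baseChangeHom σ.symm.toRingHom)
    (idIso₁.symm ≪≫ eqToIso (by rw [h₂]) ≪≫ baseChangeHomCompIso σ.toRingHom σ.symm.toRingHom)
    ((baseChangeHomCompIso σ.symm.toRingHom σ.toRingHom).symm ≪≫ eqToIso (by rw [h₁]) ≪≫ idIso₂), rfl⟩

/-- **`f ↦ f ⊗_σ R₂` is bijective on morphisms** for a ring ISOMORPHISM `σ` (base change along `σ` is fully faithful).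
[cite: GortzWedhorn2020, Prop. 4.16 and §(4.7)] -/
theorem baseChangeHom_ringEquiv_map_bijective (σ : R₁ ≃+* R₂) (X Y : SchemeOver R₁) :
    Function.Bijective fun f : X ⟶ Y => (baseChangeHom σ.toRingHom).map f := by
  obtain ⟨e, he⟩ := exists_equivalence_baseChangeHom_ringEquiv σ
  have h := e.fullyFaithfulFunctor.map_bijective (X := X) (Y := Y)
  rw [he] at h
  exact h

/-- The counit of the equivalence: `(X ⊗_σ R₂) ⊗_{σ⁻¹} R₁ ≅ X`, recorded as existence (transitivity + `Spec id = 𝟙`).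
[cite: GortzWedhorn2020, Prop. 4.16 and §(4.7)] -/
theorem nonempty_iso_baseChangeHom_symm_obj_baseChangeHom_obj (σ : R₁ ≃+* R₂) (X : SchemeOver R₁) :
    Nonempty ((baseChangeHom σ.symm.toRingHom).obj ((baseChangeHom σ.toRingHom).obj X) ≅ X) := by
  have h₂ : σ.symm.toRingHom.comp σ.toRingHom = RingHom.id R₁ := by
    ext x; simp
  let idIso₁ : (baseChangeHom (RingHom.id R₁) : SchemeOver R₁ ⥤ SchemeOver R₁) ≅ 𝟭 _ :=
    eqToIso baseChangeHom_id_eq_pullback_id ≪≫ Over.pullbackId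
  exact ⟨((baseChangeHomCompIso σ.toRingHom σ.symm.toRingHom).symm ≪≫ eqToIso (by rw [h₂]) ≪≫ idIso₁).app X⟩

end RingEquiv

/-! ## Transport of the Néron mapping property along a base automorphism -/

section Neron

variable {R₀ K : Type u} [CommRing R₀] [Field K] [Algebra R₀ K]

/-- **The Néron mapping property is stable under base change along an automorphism of the base** ([BLRNeronModels1990] 1.2
Prop. 2; transport of structure).  Let `φ` be a ring automorphism of `R₀` under the automorphism `γ` of `K ⊇ R₀`
(`algebraMap ∘ φ = γ ∘ algebraMap`).  If `𝒩 → Spec R₀` has the Néron mapping property for the generic-fibre functor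
(`IsNeronModel.mappingProperty`: for every SMOOTH `𝒳 → Spec R₀` the map `Hom_{R₀}(𝒳, 𝒩) → Hom_K(𝒳_K, 𝒩_K)` is bijective),
then so has the conjugate model `𝒩 ⊗_{R₀, φ} R₀ = (baseChangeHom φ).obj 𝒩`.  Proof: `Hom(𝒳, φ^*𝒩) ≃ Hom(φ⁻¹^*𝒳, 𝒩)`
(`baseChangeHom φ⁻¹` is fully faithful, counit `φ⁻¹^*φ^*𝒩 ≅ 𝒩`); `φ⁻¹^*𝒳` is smooth; the generic fibre of `φ⁻¹^*(-)` is the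
`γ⁻¹`-conjugate of the generic fibre (`baseChangeHomCommIso`, from `algebraMap ∘ φ⁻¹ = γ⁻¹ ∘ algebraMap`), and
`γ⁻¹`-conjugation of `K`-schemes is fully faithful; the induced bijections intertwine the two generic-fibre maps by naturality.
[cite: BLRNeronModels1990, §1.2 Prop. 2] [cite: Shimura1998, §18.6 proof of Thm. 18.6, p. 129] -/
theorem mappingProperty_baseChangeHom_ringEquiv (φ : R₀ ≃+* R₀) (γ : K ≃+* K)
    (hφγ : (algebraMap R₀ K).comp φ.toRingHom = γ.toRingHom.comp (algebraMap R₀ K))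
    {𝒩 : SchemeOver R₀}
    (hN : ∀ 𝒳 : SchemeOver R₀, Smooth 𝒳.hom →
      Function.Bijective fun f : 𝒳 ⟶ 𝒩 => (genericFibre R₀ K).map f)
    (𝒳 : SchemeOver R₀) (h𝒳 : Smooth 𝒳.hom) :
    Function.Bijective fun f : 𝒳 ⟶ (baseChangeHom φ.toRingHom).obj 𝒩 => (genericFibre R₀ K).map f := by
  classical
  -- notation: `Φ = φ^*`, `Ψ = φ⁻¹^*` on `R₀`-schemes; `G` = generic fibre; `Γ' = γ⁻¹`-conjugation on `K`-schemes
  let Φ : SchemeOver R₀ ⥤ SchemeOver R₀ := baseChangeHom φ.toRingHom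
  let Ψ : SchemeOver R₀ ⥤ SchemeOver R₀ := baseChangeHom φ.symm.toRingHom
  let G : SchemeOver R₀ ⥤ SchemeOver K := baseChangeHom (algebraMap R₀ K)
  let Γ' : SchemeOver K ⥤ SchemeOver K := baseChangeHom γ.symm.toRingHom
  -- `algebraMap ∘ φ⁻¹ = γ⁻¹ ∘ algebraMap`
  have hφγ' : (algebraMap R₀ K).comp φ.symm.toRingHom = γ.symm.toRingHom.comp (algebraMap R₀ K) := by
    ext x
    have h := congrArg (fun ψ : R₀ →+* K => ψ (φ.symm x)) hφγ
    simp only [RingHom.coe_comp, Function.comp_apply, RingEquiv.toRingHom_eq_coe, RingEquiv.coe_toRingHom,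
      RingEquiv.apply_symm_apply] at h
    simp only [RingHom.coe_comp, Function.comp_apply, RingEquiv.toRingHom_eq_coe, RingEquiv.coe_toRingHom, h,
      RingEquiv.symm_apply_apply]
  -- (E1) `Ψ` and `Γ'` are fully faithful; (E2) the counit `c : Ψ (Φ 𝒩) ≅ 𝒩`; (E3) `α : Ψ ⋙ G ≅ G ⋙ Γ'`
  --      (`c` and `α` are kept OPAQUE — destructured from `Nonempty` — so that no transport term is ever unfolded)
  have hΨff := baseChangeHom_ringEquiv_map_bijective φ.symm 𝒳 (Φ.obj 𝒩)
  have hΓff := baseChangeHom_ringEquiv_map_bijective γ.symm (G.obj 𝒳) (G.obj (Φ.obj 𝒩))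
  obtain ⟨c⟩ : Nonempty (Ψ.obj (Φ.obj 𝒩) ≅ 𝒩) := nonempty_iso_baseChangeHom_symm_obj_baseChangeHom_obj φ 𝒩
  obtain ⟨α⟩ : Nonempty (Ψ ⋙ G ≅ G ⋙ Γ') :=
    ⟨baseChangeHomCommIso φ.symm.toRingHom (algebraMap R₀ K) (algebraMap R₀ K) γ.symm.toRingHom hφγ'⟩
  -- the two components of `α` we use, with their objects spelled uniformly, and the naturality square
  let aX : G.obj (Ψ.obj 𝒳) ≅ Γ'.obj (G.obj 𝒳) := α.app 𝒳
  let aN : G.obj (Ψ.obj (Φ.obj 𝒩)) ≅ Γ'.obj (G.obj (Φ.obj 𝒩)) := α.app (Φ.obj 𝒩)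
  have nat : ∀ f : 𝒳 ⟶ Φ.obj 𝒩, G.map (Ψ.map f) = aX.hom ≫ Γ'.map (G.map f) ≫ aN.inv :=
    fun f => (NatIso.naturality_2 α f).symm
  -- `T : Hom(𝒳, Φ𝒩) → Hom(Ψ𝒳, 𝒩)`, `f ↦ Ψ f ≫ c`, bijective
  let T : (𝒳 ⟶ Φ.obj 𝒩) → (Ψ.obj 𝒳 ⟶ 𝒩) := fun f => Ψ.map f ≫ c.hom
  have hpost : Function.Bijective fun g : Ψ.obj 𝒳 ⟶ Ψ.obj (Φ.obj 𝒩) => g ≫ c.hom :=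
    ⟨fun g₁ g₂ h => (cancel_mono c.hom).1 h, fun g => ⟨g ≫ c.inv, by simp⟩⟩
  have hT : Function.Bijective T := hpost.comp hΨff
  -- `B : Hom(G𝒳, GΦ𝒩) → Hom(GΨ𝒳, G𝒩)`, `u ↦ (α_𝒳 ≫ Γ' u ≫ α_{Φ𝒩}⁻¹) ≫ G c`, bijective
  let B : (G.obj 𝒳 ⟶ G.obj (Φ.obj 𝒩)) → (G.obj (Ψ.obj 𝒳) ⟶ G.obj 𝒩) := fun u =>
    (aX.hom ≫ Γ'.map u ≫ aN.inv) ≫ G.map c.hom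
  have hpostB : Function.Bijective fun w : Γ'.obj (G.obj 𝒳) ⟶ Γ'.obj (G.obj (Φ.obj 𝒩)) =>
      (aX.hom ≫ w ≫ aN.inv) ≫ G.map c.hom := by
    refine ⟨fun w₁ w₂ h => ?_, fun y => ⟨aX.inv ≫ (y ≫ G.map c.inv) ≫ aN.hom, ?_⟩⟩
    · have h1 := (cancel_mono (G.map c.hom)).1 h
      have h2 := (cancel_epi aX.hom).1 h1
      exact (cancel_mono aN.inv).1 h2
    · simp only [Category.assoc, Iso.hom_inv_id_assoc, Iso.map_inv_hom_id, Category.comp_id]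
  have hB : Function.Bijective B := hpostB.comp hΓff
  -- `Ψ 𝒳` is smooth, so `𝒩` has the mapping property at it
  have hΨ𝒳 : Smooth (Ψ.obj 𝒳).hom := MorphismProperty.baseChange_obj _ _ h𝒳
  have hS : Function.Bijective fun g : Ψ.obj 𝒳 ⟶ 𝒩 => G.map g := hN (Ψ.obj 𝒳) hΨ𝒳
  -- the key intertwining identity `G (T f) = B (G f)` (functoriality of `G`, naturality of `α`)
  have key : ∀ f : 𝒳 ⟶ Φ.obj 𝒩, G.map (T f) = B (G.map f) := by
    intro f
    change G.map (Ψ.map f ≫ c.hom) = (aX.hom ≫ Γ'.map (G.map f) ≫ aN.inv) ≫ G.map c.hom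
    rw [G.map_comp, nat]
  -- conclude
  change Function.Bijective fun f : 𝒳 ⟶ Φ.obj 𝒩 => G.map f
  constructor
  · intro f g hfg
    apply hT.1
    apply hS.1
    change G.map (T f) = G.map (T g)
    rw [key, key]
    exact congrArg B hfg
  · intro u
    obtain ⟨g, hg⟩ := hS.2 (B u)
    obtain ⟨f, rfl⟩ := hT.2 g
    refine ⟨f, hB.1 ?_⟩
    change B (G.map f) = B u
    rw [← key]
    exact hg

end Neron

end Literature.AlgebraicGeometry.Motives
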